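import Summits.QuantumFields.YangMills.Theorems.PoincareLipschitzImproveCoreOfFlat
import Summits.QuantumFields.YangMills.Theorems.PoincareLipschitzImproveOfCore
import Summits.QuantumFields.YangMills.Theorems.PoincareLipschitzHistoryTailOfImprove
import Summits.QuantumFields.YangMills.Theorems.PoincareLipschitzFlatOrganOfFlatCapped
import Summits.QuantumFields.YangMills.Theorems.PoincareLipschitzBlowDownL2Compactness
import Summits.QuantumFields.YangMills.Theorems.PoincareLipschitzSamplingCells
import Literature.Analysis.FunctionSpaces.SobolevDomain
import Literature.MathematicalPhysics.QuantumFieldTheory.Balaban1983to89.B4Eq19LatticeOperators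
import Mathlib.Analysis.InnerProductSpace.PiL2
import Mathlib.MeasureTheory.Integral.Bochner.Basic
import Mathlib.MeasureTheory.Integral.Bochner.Set
import Mathlib.MeasureTheory.Measure.Haar.InnerProductSpace
import Mathlib.MeasureTheory.Function.StronglyMeasurable.AEStronglyMeasurable

/-!
# LINE 25 «CompactnessTransfer» v1.4-band (A″) (SOBOLEV RESHAPE S1″/S2♭″ + THE BAND `Λ ≤ 21`; Γ1 LANDED ✓p718508 and DISCHARGED BY NAME) — crux `HistoryTailL`
# (stmt-QuantumFields-19936) · K2 crux `BlockLipschitzL` (stmt-QuantumFields-23533) of route PoincareLipschitz · organ of record `hImproveCoreFlat` (FROZEN v1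
# bac8eda30a54887f) by ROAD (R1) «blow-down + discrete Luckhaus + Schoen–Uhlenbeck 1982/84» (w8 LOCATE-hImprove-roads v1.9 §11/§13/§14).

Ideator seat ym-r3-idea-2 (g14 texts, g15 registration), lens «nearmiss».  bears_on LADDER-YM rung R3 (leaf `T3YM3TorusStatement.YM3TorusSU2`, closed BY NAME
through `UnitScaleTilt.closes`); no summit, no rung, no crux, no mass gap is proved here; YM₃ on T³ is NOT d = 4, NOT infinite volume, NOT Clay.

WORDS OF RECORD FOR THIS VERSION.  LEAD ★w1-19936 g10 2026-08-29T12:24:26Z: «(a) S1″ PASS» (texts `S1S2-sobolev-texts.v14.lean` adf1eba61d4d4480 read in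
full) and «(c) BAND PASS — register S1″ WITH the extra binder `Λ ≤ 21 →`»; LEAD 12:29:32Z S2♭″ ARCHITECTURE v0 (brick list below; «no new named fact is
needed»); ★★OWNER ym3-torus-plan g31 RECORD 16x 12:29:09Z (Γ1 credit event ✓p718508, four checks PASS; WORD 20 (c) discharged; Γ1 text byte-identical
across versions).  v1.3 (260fb13c43e43c58, critic idea-crit-5 #307 PASS) is superseded by this file; v1.3's S1′/S2♭ (`C¹` dialect, LEAD g9 49b989ff) are
replaced by S1″/S2♭″ below — the `C¹` texts were TRUE readings too, but they forced a regularity theorem (Schoen–Uhlenbeck 1984) INSIDE the lattice stub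
S2♭; v1.4 moves all continuum regularity into the continuum stub S1″, so that S2♭″ is pure compactness + lower semicontinuity + recovery (LEAD 11:21Z cut, ★w8).

THE NEAR MISS.  The continuum twin of the organ — «a Dirichlet-energy (almost-)minimising map `B³ → S³` with bounded normalised energy has SMALL normalised
energy at one comparable scale about the centre» — IS a theorem (Schoen–Uhlenbeck: `d(3) = 3`, sing = ∅, uniform interior estimate; Luckhaus: compactness
of (almost-)minimisers), and the cell has even made the continuum chain compactness-free with explicit constants (★w3 memo #57 / w8 §2–§5).  The MEASURED
DEFICIT is the lattice: every transcription of the self-similar (cone) competitor to `ℤ³` loses an `O(1)` factor (w8 §6.7 numerics: `E(cone)/E(u)` =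
1.11–1.15 flat in `R`; dichotomy §6.8), and `1 + O(1)` is fatal (§6.3).  THE SINGLE INPUT TO IMPROVE is the transfer itself: Luckhaus' layer lemma asks
`L²`-closeness of slices, not smoothness, and its slice energies enter multiplied by the layer thickness `λ`, so an `O(1)` lattice distortion is
ABSORBED (w8 §13 (Γ3-TEXT)) — road (R1) escapes the §6.8 dichotomy.  THE BAND: the K2 organ is needed only for normalised energies `Λ ≤ 21` (★w3 ✓H
p715759 `hImproveCoreFlat_of_flatCapped`: the flat organ AT LEVEL 21 implies the frozen organ at every level, by the log-cutoff stability cap), and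
`21 < 8π = 25.13…` is BELOW the energy density of any non-constant tangent map `ℝ³ → S³` (degree-one bubble `8π`), so in the band the continuum fact is
gap ε-regularity + monotonicity + compactness — `d(3) = 3` is not even invoked.

SHAPE (v1.4-band).  TWO open registered stubs, ONE landed stub discharged by name, and KERNEL-CHECKED compositions:
* `stub_uniformSmallScaleEnergy` — S1″ (continuum; Literature-fact shaped; OPEN, XL as a formalisation, TRUE in print): uniform small-scale energy at the
  centre for `W^{1,2}` unit-`S³`-valued maps on the open unit cube `Q` of `ℝ³` (weak gradient `HasWeakFDerivOn ⟨Q,hQ⟩ volume U G`, integrable Dirichlet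
  density) that minimise the Dirichlet energy among ALL `W^{1,2}` unit competitors agreeing with them (pointwise) off a compact concentric sub-cube, with
  energy `≤ Λ`, FOR `Λ ≤ 21` ONLY (the band).  Text = g14 `S1pp` (LEAD (a) PASS) + the binder `Λ ≤ 21 →` (LEAD (c)).  [Schoen–Uhlenbeck 1982 Thms II–IV,
  1984 (`d(3) = 3`); Luckhaus 1988 Thm 2; Simon 1996 §2.10.]
* `stub_blowDownL2Compact` — (Γ1-PC) «DISCRETE RELLICH ON THE CUBE»: LANDED ✓p718508 (★px3 g7:
  `Theorems/PoincareLipschitzCompactnessTransferBlowDownL2CompactStub.lean`, alias of ✓p718032 `PoincareLipschitzBlowDownL2Compactness.blowDown_L2_compact`;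
  A″ form: discharged by `blowDown_L2_compact` itself, ★★OWNER WORD 21 12:56:27Z);
  kept here with its statement BYTE-IDENTICAL to the registry signature (1111 chars, sha16 4a7db0c7879e17a5) and DISCHARGED BY NAME (no `sorry`).
* `stub_latticeToContinuumLimit` — S2♭″ (lattice → continuum, GIVEN Γ1's limit; OPEN, XL): for the almost-minimising bounded-energy unit lattice sequence
  and an `L²`-limit `U₀` of its blow-downs along `φ₀` with the dyadic block-mean limits (Γ1's output, taken as hypotheses): a representative `U = U₀`
  a.e. which is unit on `Q`, has a weak gradient `G` on `Q` with integrable density, MINIMISES among all `W^{1,2}` unit competitors agreeing with it off a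
  compact concentric sub-cube, has energy `≤ Λ₀`, and onto whose energies the LATTICE ENERGIES CONVERGE FROM ABOVE at comparable scales along a further
  subsequence `φ = φ₀ ∘ ψ`.  Text = g14 `S2flatpp` (read by LEAD).  NO regularity theorem inside.  Bricks (LEAD S2♭″ ARCHITECTURE v0, 12:29:32Z; pens
  named): (Γ2-W) weak `L²` limit of the rescaled forward differences from the dyadic means — ★w8 g8 ✓p719025 `PoincareLipschitzDyadicMeansWeakLimit`,
  FILE B `…WeakLimitCube.exists_weakLimit_of_dyadicMeans` ⧗p719204, FILE C socket; (Γ2-IBP) «the `L²`-limit of the blow-downs has weak gradient = the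
  weak limit of the rescaled differences» — LEAD pen `Theorems/PoincareLipschitzBlowDownWeakGradient.lean`; (Γ2-lsc) energy lower semicontinuity on
  sub-cubes; (Γ5a) Sobolev cell-average rows — px15 g6 `Theorems/PoincareLipschitzSobolevCellAverages.lean`; (Γ5b′) unit lattice maps from sub-unit ones
  (HKL ray projection) — w7 g13 H-5 `Theorems/PoincareLipschitzLatticeSubunitProjection.lean`; (Γ5) Sobolev sampling consistency = Γ5a ∘ Γ5b ∘ counting
  (w7); (✓glue) discrete Luckhaus layer — w7 ✓p714031 `PoincareLipschitzLatticeLuckhausHKL.exists_unit_interpolant`, ✓p715429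
  `PoincareLipschitzLatticeLuckhausAnnulus.exists_unit_glue_annulus`; (Γ-layer) cubical-layer pigeonhole — px5 g8; (Γ-KNIT) S2♭″ from the bricks — px3
  (offer) or LEAD lineage.  Linear rows are tree theorems: lit ✓`SobolevDifferenceQuotients.eLpNorm_diffQuot_le`, lit ✓`PoincareWirtingerConvex`.
* `hImproveCoreFlatBand_of` — (Γ6-band), PROVED: S1″-band + Γ1 + S2♭″ imply the flat organ text ON THE BAND `0 < Λ₀ ≤ 21` (by contradiction:
  counterexamples at `δ = 1/(k+1)`, `C₀ = R₀ = k+1`; Γ1 then S2♭″; S1″ at `ε₁/10`; the energy-convergence clause at `r₀ = r₁/5`, `η = ε₁r₁/40`; the integer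
  radius `ρ ∈ [rR, 2rR]` is a forbidden good scale).
* `hImproveCoreFlat_of` — the FROZEN organ v1 VERBATIM := ★w3 ✓H `hImproveCoreFlat_of_flatCapped` at `Λ₀ := 21` ∘ (Γ6-band) (road (i), K-independent);
  `hHalvingBand_of` — LEAD's `hHalvingBand` v1 (FROZEN ba43742f358b062d) VERBATIM := (Γ6-band) at `(Λ₀, ε₁) = (Λ, Λ)` (face road (ii), feeds K-7
  `historyTailL_of_halvingBand` ⧗p718708 when it lands); `BlockLipschitzL_of` / `HistoryTailL_of (hK1)(hM)` — the crux decls BY NAME via ✓K-5 → ✓K-4b →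
  ✓K-3/✓K-3c, exactly as v1.3.

Dialect: maps `U : ℝ³ → ℝ⁴` (`EuclideanSpace`); `Q = {x | ∀ i, |x i| < 1}` (open, `hQ` a binder); weak gradients `G : ℝ³ → (ℝ³ →L[ℝ] ℝ⁴)` in the sense of
`Literature.Analysis.FunctionSpaces.HasWeakFDerivOn ⟨Q,hQ⟩ volume U G` (test functions `C^∞` with compact support in `Q`); Dirichlet density
`∑ i, ‖G x eᵢ‖²` (`IntegrableOn … Q`), energies `∫ x in {‖x‖_∞ < s}, …`; competitors agree with `U` pointwise off `{‖x‖_∞ < s}` for some `s < 1` (a.e.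
agreement gives the same class up to a null modification, which `HasWeakFDerivOn` does not see); blow-downs are PIECEWISE CONSTANT `x ↦ u k (z k + ⌊R k·x⌋)`.
-/

set_option autoImplicit false

noncomputable section

open scoped BigOperators
open Filter Topology Finset MeasureTheory

namespace Summit.QuantumFields.YangMills.Cruxes.HistoryTailL.CompactnessTransfer

open Literature.MathematicalPhysics.QuantumFieldTheory.Balaban1983to89
open B4Eq19LatticeOperators (Zd box unitVec)

/-! ## §1 The stubs: S1″ (open), Γ1 (landed, by name), S2♭″ (open) -/

/-- **STUB S1″ «UNIFORM SMALL-SCALE ENERGY FOR `W^{1,2}` LOCAL MINIMISERS `Q → S³` IN THE BAND `Λ ≤ 21`»** (continuum; Literature-fact shaped; OPEN).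
For every energy bound `0 < Λ ≤ 21` and every `ε > 0` there is `r₁ ∈ (0, 1/8]` such that every map `U` on the open unit cube `Q` of `ℝ³` with values
in the unit sphere of `ℝ⁴`, with a weak gradient `G` on `Q` of integrable Dirichlet density, which minimises the Dirichlet energy among all such maps
agreeing with it off a compact concentric sub-cube, and whose energy is `≤ Λ`, has energy `≤ ε·r` on the concentric cube of half-side `r`, for all
`r ≤ r₁`.  TRUE IN PRINT: minimisers `B³ → S³` are smooth (Schoen–Uhlenbeck 1984, `d(3) = 3`) with the uniform interior gradient bound
`sup_{Q_{1/2}} |∇U|² ≤ C(Λ)` (ε-regularity + compactness of minimisers, Schoen–Uhlenbeck 1982 §4 / Luckhaus 1988 Thm 2); in the band `Λ ≤ 21 < 8π` no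
non-constant tangent map exists, so gap ε-regularity + monotonicity already suffice.  WHY IT MIGHT FAIL: only through the typing — the minimality class
(competitors = all `W^{1,2}` unit maps agreeing POINTWISE off `Q_s`, `s < 1`, which up to null sets is the printed class of compactly supported
`W^{1,2}` variations) or the pointwise unit-norm convention on the open cube; both were read and PASSED by LEAD ★w1-19936 g10 (a)(c).  NOT proved here;
a typer item in `Literature/Analysis` vocabulary is the intended discharge. [cite: SchoenUhlenbeck1982, Thm IV; SchoenUhlenbeck1984, Thm (d(3)=3);
Luckhaus1988, Thm 2; Simon1996, §2.10] -/
theorem stub_uniformSmallScaleEnergy :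
    ∀ (Λ ε : ℝ), 0 < Λ → Λ ≤ 21 → 0 < ε → ∃ r₁ : ℝ, 0 < r₁ ∧ r₁ ≤ 1 / 8 ∧
      ∀ (hQ : IsOpen {x : EuclideanSpace ℝ (Fin 3) | ∀ i : Fin 3, |x i| < 1}) (U : EuclideanSpace ℝ (Fin 3) → EuclideanSpace ℝ (Fin 4)) (G : EuclideanSpace ℝ (Fin 3) → (EuclideanSpace ℝ (Fin 3) →L[ℝ] EuclideanSpace ℝ (Fin 4))),
      Literature.Analysis.FunctionSpaces.HasWeakFDerivOn ⟨{x : EuclideanSpace ℝ (Fin 3) | ∀ i : Fin 3, |x i| < 1}, hQ⟩ volume U G →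
      (∀ x : EuclideanSpace ℝ (Fin 3), (∀ i : Fin 3, |x i| < 1) → ‖U x‖ = 1) →
      MeasureTheory.IntegrableOn (fun x => ∑ i : Fin 3, ‖G x (EuclideanSpace.single i (1:ℝ))‖ ^ 2)
        {x : EuclideanSpace ℝ (Fin 3) | ∀ i : Fin 3, |x i| < 1} →
      (∀ (V : EuclideanSpace ℝ (Fin 3) → EuclideanSpace ℝ (Fin 4)) (GV : EuclideanSpace ℝ (Fin 3) → (EuclideanSpace ℝ (Fin 3) →L[ℝ] EuclideanSpace ℝ (Fin 4))) (s : ℝ), s < 1 →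
        Literature.Analysis.FunctionSpaces.HasWeakFDerivOn ⟨{x : EuclideanSpace ℝ (Fin 3) | ∀ i : Fin 3, |x i| < 1}, hQ⟩ volume V GV →
        (∀ x : EuclideanSpace ℝ (Fin 3), (∀ i : Fin 3, |x i| < 1) → ‖V x‖ = 1) →
        MeasureTheory.IntegrableOn (fun x => ∑ i : Fin 3, ‖GV x (EuclideanSpace.single i (1:ℝ))‖ ^ 2)
        {x : EuclideanSpace ℝ (Fin 3) | ∀ i : Fin 3, |x i| < 1} →
        (∀ x : EuclideanSpace ℝ (Fin 3), (∃ i : Fin 3, s ≤ |x i|) → V x = U x) →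
        ∫ x in {x : EuclideanSpace ℝ (Fin 3) | ∀ i : Fin 3, |x i| < 1}, ∑ i : Fin 3, ‖G x (EuclideanSpace.single i (1:ℝ))‖ ^ 2 ≤
          ∫ x in {x : EuclideanSpace ℝ (Fin 3) | ∀ i : Fin 3, |x i| < 1}, ∑ i : Fin 3, ‖GV x (EuclideanSpace.single i (1:ℝ))‖ ^ 2) →
      ∫ x in {x : EuclideanSpace ℝ (Fin 3) | ∀ i : Fin 3, |x i| < 1}, ∑ i : Fin 3, ‖G x (EuclideanSpace.single i (1:ℝ))‖ ^ 2 ≤ Λ →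
      ∀ r : ℝ, 0 < r → r ≤ r₁ →
        ∫ x in {x : EuclideanSpace ℝ (Fin 3) | ∀ i : Fin 3, |x i| < r}, ∑ i : Fin 3, ‖G x (EuclideanSpace.single i (1:ℝ))‖ ^ 2 ≤ ε * r := by
  sorry

/-- **Γ1 (Γ1-PC) «DISCRETE RELLICH ON THE CUBE» — LANDED ✓p718508, DISCHARGED BY NAME.**  `L²`-strong compactness of the piecewise-constant blow-downs
of bounded-energy unit lattice maps + convergence of the dyadic block means of the rescaled discrete gradients along the same subsequence.  Statement =
px3 g7 SIGNATURE-0 093526177ac80f17 = registry signature of `stub_blowDownL2Compact` on stmt-QuantumFields-23533 (1111 chars, sha16 4a7db0c7879e17a5)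
BYTE-IDENTICAL; proof = ★px3 g7 ✓p718032 `PoincareLipschitzBlowDownL2Compactness.blowDown_L2_compact` DIRECTLY (A″ form, ★★OWNER WORD 21 12:56:27Z:
the theorem by which the STUB alias ✓p718508 `PoincareLipschitzCompactnessTransferBlowDownL2CompactStub.stub_blowDownL2Compact` is defined; Kolmogorov–M. Riesz–
Fréchet in translation form + the `L²`-translation modulus from the bond energy + Tychonoff on the dyadic means). [cite: AlicandroCicalese2008, Thm 4.1; Giaquinta1984, Ch. III §1 Thm 1.2] -/
theorem stub_blowDownL2Compact :
    ∀ (Λ₀ : ℝ), 0 < Λ₀ → ∀ (u : ℕ → Zd 3 → EuclideanSpace ℝ (Fin 4)) (z : ℕ → Zd 3) (R : ℕ → ℤ),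
      (∀ k : ℕ, (k : ℝ) + 1 ≤ R k) → (∀ (k : ℕ) (y : Zd 3), ‖u k y‖ = 1) →
      (∀ k : ℕ, ∑ y ∈ box (z k) (R k), ∑ μ : Fin 3, ‖(u k) (y + unitVec μ) - (u k) y‖ ^ 2 ≤ Λ₀ * R k) →
      ∃ (U : EuclideanSpace ℝ (Fin 3) → EuclideanSpace ℝ (Fin 4)) (φ : ℕ → ℕ), StrictMono φ ∧
        AEStronglyMeasurable U (volume.restrict {x : EuclideanSpace ℝ (Fin 3) | ∀ i : Fin 3, |x i| < 1}) ∧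
        (∀ᵐ x ∂(volume.restrict {x : EuclideanSpace ℝ (Fin 3) | ∀ i : Fin 3, |x i| < 1}), ‖U x‖ = 1) ∧
        Tendsto (fun k : ℕ => ∫ x in {x : EuclideanSpace ℝ (Fin 3) | ∀ i : Fin 3, |x i| < 1},
            ‖u (φ k) (z (φ k) + fun i => ⌊(R (φ k) : ℝ) * x i⌋) - U x‖ ^ 2) atTop (𝓝 0) ∧
        (∀ (m : ℕ) (j : Fin 3 → Fin (2 ^ m)) (μ : Fin 3), ∃ g : EuclideanSpace ℝ (Fin 4),
          Tendsto (fun k : ℕ => ∫ x in {x : EuclideanSpace ℝ (Fin 3) |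
                ∀ i : Fin 3, (-1 : ℝ) + 2 * (j i : ℕ) / (2 : ℝ) ^ m ≤ x i ∧ x i < (-1 : ℝ) + 2 * ((j i : ℕ) + 1) / (2 : ℝ) ^ m},
              (R (φ k) : ℝ) • (u (φ k) ((z (φ k) + fun i => ⌊(R (φ k) : ℝ) * x i⌋) + unitVec μ)
                - u (φ k) (z (φ k) + fun i => ⌊(R (φ k) : ℝ) * x i⌋))) atTop (𝓝 g)) :=
  Summit.QuantumFields.YangMills.Theorems.PoincareLipschitzBlowDownL2Compactness.blowDown_L2_compact

/-- **STUB S2♭″ «THE BLOW-DOWN LIMIT IS A `W^{1,2}` LOCAL MINIMISER AND THE LATTICE ENERGIES CONVERGE ONTO IT FROM ABOVE»** (lattice → continuum, GIVEN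
Γ1's limit; OPEN, XL).  Hypotheses: the almost-minimising bounded-energy unit lattice sequence AND an `L²`-limit `U₀` of its piecewise-constant blow-downs
along `φ₀` with the dyadic block-mean limits (= the conclusion of `stub_blowDownL2Compact`, supplied to it in (Γ6-band)).  Conclusion: a representative
`U = U₀` a.e. on `Q`, unit on `Q`, with a weak gradient `G` on `Q` (`HasWeakFDerivOn`) of integrable Dirichlet density, minimising among all `W^{1,2}`
unit competitors agreeing with it off a compact concentric sub-cube, of energy `≤ Λ₀`, and a further subsequence `φ = φ₀ ∘ ψ` along which the lattice
energies at comparable scales converge onto `U`'s FROM ABOVE (no energy loss).  NO regularity theorem inside (that is S1″'s).  Content and pens (LEAD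
S2♭″ ARCHITECTURE v0): (Γ2-W) ★w8 ✓p719025 / ⧗p719204 weak `L²` limit of the rescaled forward differences from the dyadic means; (Γ2-IBP) LEAD — the
`L²`-limit has weak gradient = that weak limit (change of variables under the test function, no face integrals); (Γ2-lsc) weak lower semicontinuity on
sub-cubes; (Γ5a) px15 Sobolev cell-average rows (lit ✓`SobolevDifferenceQuotients.eLpNorm_diffQuot_le`, lit ✓`PoincareWirtingerConvex`); (Γ5b′) w7 H-5
unit lattice maps from sub-unit ones by the Hardt–Kinderlehrer–Lin ray projection (✓`PoincareLipschitzSphereRayProjection`, ✓`exists_centre_weighted_le`);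
(Γ5) w7 Sobolev sampling consistency for an ARBITRARY `W^{1,2}(Q;S³)` competitor (bad cells cost `o(R)` by absolute continuity of `∫ dens`); (✓glue) w7
✓p714031 `exists_unit_interpolant` / ✓p715429 `exists_unit_glue_annulus` — the discrete Luckhaus layer, whose slice energies carry the layer thickness
`λ`; (Γ-layer) px5 cubical-layer pigeonhole; (Γ-KNIT) px3 / LEAD lineage.  NOT in print on the lattice; NOT proved here.  WHY IT MIGHT FAIL: only through a
lattice-specific energy loss in the pasting step — exactly what the Luckhaus layer excludes — or in the recovery sequence for a rough competitor, where
the HKL projection bounds the bad-cell cost by `C·R·∫_{bad cells} dens = o(R)`. [cite: Luckhaus1988, Lemma 1 + Thm 2; Simon1996, §2.6 Lemma 1, §2.9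
Lemma 1; HardtKinderlehrerLin1986, §2; AlicandroCicalese2008, Thm 4.1] -/
theorem stub_latticeToContinuumLimit :
    ∀ (Λ₀ : ℝ), 0 < Λ₀ → ∀ (u : ℕ → Zd 3 → EuclideanSpace ℝ (Fin 4)) (z : ℕ → Zd 3) (R : ℕ → ℤ),
      (∀ k : ℕ, (k : ℝ) + 1 ≤ R k) → (∀ (k : ℕ) (y : Zd 3), ‖u k y‖ = 1) →
      (∀ k : ℕ, (∀ (z' : Zd 3) (ρ : ℤ), 0 ≤ ρ → box z' (ρ + 1) ⊆ box (z k) (R k) →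
        ∀ v : Zd 3 → EuclideanSpace ℝ (Fin 4), (∀ y, y ∉ box z' ρ → v y = (u k) y) → (∀ y ∈ box z' ρ, ‖v y‖ = 1) →
        ∑ y ∈ box z' (ρ + 1), ∑ μ : Fin 3, ‖(u k) (y + unitVec μ) - (u k) y‖ ^ 2 ≤
        (∑ y ∈ box z' (ρ + 1), ∑ μ : Fin 3, ‖v (y + unitVec μ) - v y‖ ^ 2) + (1 / ((k : ℝ) + 1)) * ((ρ : ℝ) + 1))) →
      (∀ k : ℕ, ∑ y ∈ box (z k) (R k), ∑ μ : Fin 3, ‖(u k) (y + unitVec μ) - (u k) y‖ ^ 2 ≤ Λ₀ * R k) →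
      ∀ (U₀ : EuclideanSpace ℝ (Fin 3) → EuclideanSpace ℝ (Fin 4)) (φ₀ : ℕ → ℕ), StrictMono φ₀ →
      AEStronglyMeasurable U₀ (volume.restrict {x : EuclideanSpace ℝ (Fin 3) | ∀ i : Fin 3, |x i| < 1}) →
      (∀ᵐ x ∂(volume.restrict {x : EuclideanSpace ℝ (Fin 3) | ∀ i : Fin 3, |x i| < 1}), ‖U₀ x‖ = 1) →
      Tendsto (fun k : ℕ => ∫ x in {x : EuclideanSpace ℝ (Fin 3) | ∀ i : Fin 3, |x i| < 1},
            ‖u (φ₀ k) (z (φ₀ k) + fun i => ⌊(R (φ₀ k) : ℝ) * x i⌋) - U₀ x‖ ^ 2) atTop (𝓝 0) →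
      (∀ (m : ℕ) (j : Fin 3 → Fin (2 ^ m)) (μ : Fin 3), ∃ g : EuclideanSpace ℝ (Fin 4),
          Tendsto (fun k : ℕ => ∫ x in {x : EuclideanSpace ℝ (Fin 3) |
                ∀ i : Fin 3, (-1 : ℝ) + 2 * (j i : ℕ) / (2 : ℝ) ^ m ≤ x i ∧ x i < (-1 : ℝ) + 2 * ((j i : ℕ) + 1) / (2 : ℝ) ^ m},
              (R (φ₀ k) : ℝ) • (u (φ₀ k) ((z (φ₀ k) + fun i => ⌊(R (φ₀ k) : ℝ) * x i⌋) + unitVec μ)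
                - u (φ₀ k) (z (φ₀ k) + fun i => ⌊(R (φ₀ k) : ℝ) * x i⌋))) atTop (𝓝 g)) →
      ∀ (hQ : IsOpen {x : EuclideanSpace ℝ (Fin 3) | ∀ i : Fin 3, |x i| < 1}), ∃ (U : EuclideanSpace ℝ (Fin 3) → EuclideanSpace ℝ (Fin 4)) (G : EuclideanSpace ℝ (Fin 3) → (EuclideanSpace ℝ (Fin 3) →L[ℝ] EuclideanSpace ℝ (Fin 4))) (φ : ℕ → ℕ),
      StrictMono φ ∧ (∃ ψ : ℕ → ℕ, StrictMono ψ ∧ ∀ k : ℕ, φ k = φ₀ (ψ k)) ∧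
      (∀ᵐ x ∂(volume.restrict {x : EuclideanSpace ℝ (Fin 3) | ∀ i : Fin 3, |x i| < 1}), U x = U₀ x) ∧
      Literature.Analysis.FunctionSpaces.HasWeakFDerivOn ⟨{x : EuclideanSpace ℝ (Fin 3) | ∀ i : Fin 3, |x i| < 1}, hQ⟩ volume U G ∧
      (∀ x : EuclideanSpace ℝ (Fin 3), (∀ i : Fin 3, |x i| < 1) → ‖U x‖ = 1) ∧
      MeasureTheory.IntegrableOn (fun x => ∑ i : Fin 3, ‖G x (EuclideanSpace.single i (1:ℝ))‖ ^ 2)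
        {x : EuclideanSpace ℝ (Fin 3) | ∀ i : Fin 3, |x i| < 1} ∧
      (∀ (V : EuclideanSpace ℝ (Fin 3) → EuclideanSpace ℝ (Fin 4)) (GV : EuclideanSpace ℝ (Fin 3) → (EuclideanSpace ℝ (Fin 3) →L[ℝ] EuclideanSpace ℝ (Fin 4))) (s : ℝ), s < 1 →
        Literature.Analysis.FunctionSpaces.HasWeakFDerivOn ⟨{x : EuclideanSpace ℝ (Fin 3) | ∀ i : Fin 3, |x i| < 1}, hQ⟩ volume V GV →
        (∀ x : EuclideanSpace ℝ (Fin 3), (∀ i : Fin 3, |x i| < 1) → ‖V x‖ = 1) →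
        MeasureTheory.IntegrableOn (fun x => ∑ i : Fin 3, ‖GV x (EuclideanSpace.single i (1:ℝ))‖ ^ 2)
        {x : EuclideanSpace ℝ (Fin 3) | ∀ i : Fin 3, |x i| < 1} →
        (∀ x : EuclideanSpace ℝ (Fin 3), (∃ i : Fin 3, s ≤ |x i|) → V x = U x) →
        ∫ x in {x : EuclideanSpace ℝ (Fin 3) | ∀ i : Fin 3, |x i| < 1}, ∑ i : Fin 3, ‖G x (EuclideanSpace.single i (1:ℝ))‖ ^ 2 ≤
          ∫ x in {x : EuclideanSpace ℝ (Fin 3) | ∀ i : Fin 3, |x i| < 1}, ∑ i : Fin 3, ‖GV x (EuclideanSpace.single i (1:ℝ))‖ ^ 2) ∧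
      ∫ x in {x : EuclideanSpace ℝ (Fin 3) | ∀ i : Fin 3, |x i| < 1}, ∑ i : Fin 3, ‖G x (EuclideanSpace.single i (1:ℝ))‖ ^ 2 ≤ Λ₀ ∧
      ∀ (r₀ η : ℝ), 0 < r₀ → r₀ ≤ 1 / 8 → 0 < η → ∃ r : ℝ, r₀ / 2 ≤ r ∧ r ≤ r₀ ∧ ∃ k₀ : ℕ, ∀ k : ℕ, k₀ ≤ k →
        ∃ ρ : ℤ, r * (R (φ k) : ℝ) ≤ ρ ∧ (ρ : ℝ) ≤ 2 * r * R (φ k) ∧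
        ∑ y ∈ box (z (φ k)) (2 * ρ), ∑ μ : Fin 3, ‖(u (φ k)) (y + unitVec μ) - (u (φ k)) y‖ ^ 2 ≤
          (R (φ k) : ℝ) * ((∫ x in {x : EuclideanSpace ℝ (Fin 3) | ∀ i : Fin 3, |x i| < (5 * r)}, ∑ i : Fin 3, ‖G x (EuclideanSpace.single i (1:ℝ))‖ ^ 2) + η) := by
  sorry

/-! ## §2 (Γ6-band) The contradiction step — PROVED: the stubs give the flat organ text on the band `0 < Λ₀ ≤ 21` -/

/-- ★★★ **The flat organ ON THE BAND from S1″-band, Γ1, S2♭″.**  By contradiction: if for some `Λ₀ ≤ 21`, `ε₁` no `(δ, C₀, R₀)` works, take the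
counterexamples at `δ = 1/(k+1)`, `C₀ = R₀ = k+1`; blow down (Γ1), then S2♭″ along a further subsequence; S1″ at `(Λ₀, ε₁/10)` gives `r₁`; the
energy-convergence clause at `r₀ = r₁/5`, `η = ε₁r₁/40` gives a radius `r ∈ [r₁/10, r₁/5]` and, for `k` large, an integer `ρ ∈ [rR, 2rR]` with lattice
energy `≤ R·(ε₁·5r/10 + ε₁r₁/40) ≤ (3/4)ε₁rR < ε₁ρ` on `box z (2ρ)` — a good scale (`1 ≤ ρ`, `R ≤ (k+1)ρ`, `4ρ ≤ R`), which the counterexample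
forbids. [cite: SchoenUhlenbeck1982, Thm IV; Luckhaus1988, Thm 2] -/
theorem hImproveCoreFlatBand_of
    (h1 : ∀ (Λ ε : ℝ), 0 < Λ → Λ ≤ 21 → 0 < ε → ∃ r₁ : ℝ, 0 < r₁ ∧ r₁ ≤ 1 / 8 ∧
      ∀ (hQ : IsOpen {x : EuclideanSpace ℝ (Fin 3) | ∀ i : Fin 3, |x i| < 1}) (U : EuclideanSpace ℝ (Fin 3) → EuclideanSpace ℝ (Fin 4)) (G : EuclideanSpace ℝ (Fin 3) → (EuclideanSpace ℝ (Fin 3) →L[ℝ] EuclideanSpace ℝ (Fin 4))),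
      Literature.Analysis.FunctionSpaces.HasWeakFDerivOn ⟨{x : EuclideanSpace ℝ (Fin 3) | ∀ i : Fin 3, |x i| < 1}, hQ⟩ volume U G →
      (∀ x : EuclideanSpace ℝ (Fin 3), (∀ i : Fin 3, |x i| < 1) → ‖U x‖ = 1) →
      MeasureTheory.IntegrableOn (fun x => ∑ i : Fin 3, ‖G x (EuclideanSpace.single i (1:ℝ))‖ ^ 2)
        {x : EuclideanSpace ℝ (Fin 3) | ∀ i : Fin 3, |x i| < 1} →
      (∀ (V : EuclideanSpace ℝ (Fin 3) → EuclideanSpace ℝ (Fin 4)) (GV : EuclideanSpace ℝ (Fin 3) → (EuclideanSpace ℝ (Fin 3) →L[ℝ] EuclideanSpace ℝ (Fin 4))) (s : ℝ), s < 1 →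
        Literature.Analysis.FunctionSpaces.HasWeakFDerivOn ⟨{x : EuclideanSpace ℝ (Fin 3) | ∀ i : Fin 3, |x i| < 1}, hQ⟩ volume V GV →
        (∀ x : EuclideanSpace ℝ (Fin 3), (∀ i : Fin 3, |x i| < 1) → ‖V x‖ = 1) →
        MeasureTheory.IntegrableOn (fun x => ∑ i : Fin 3, ‖GV x (EuclideanSpace.single i (1:ℝ))‖ ^ 2)
        {x : EuclideanSpace ℝ (Fin 3) | ∀ i : Fin 3, |x i| < 1} →
        (∀ x : EuclideanSpace ℝ (Fin 3), (∃ i : Fin 3, s ≤ |x i|) → V x = U x) →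
        ∫ x in {x : EuclideanSpace ℝ (Fin 3) | ∀ i : Fin 3, |x i| < 1}, ∑ i : Fin 3, ‖G x (EuclideanSpace.single i (1:ℝ))‖ ^ 2 ≤
          ∫ x in {x : EuclideanSpace ℝ (Fin 3) | ∀ i : Fin 3, |x i| < 1}, ∑ i : Fin 3, ‖GV x (EuclideanSpace.single i (1:ℝ))‖ ^ 2) →
      ∫ x in {x : EuclideanSpace ℝ (Fin 3) | ∀ i : Fin 3, |x i| < 1}, ∑ i : Fin 3, ‖G x (EuclideanSpace.single i (1:ℝ))‖ ^ 2 ≤ Λ →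
      ∀ r : ℝ, 0 < r → r ≤ r₁ →
        ∫ x in {x : EuclideanSpace ℝ (Fin 3) | ∀ i : Fin 3, |x i| < r}, ∑ i : Fin 3, ‖G x (EuclideanSpace.single i (1:ℝ))‖ ^ 2 ≤ ε * r)
    (hΓ : ∀ (Λ₀ : ℝ), 0 < Λ₀ → ∀ (u : ℕ → Zd 3 → EuclideanSpace ℝ (Fin 4)) (z : ℕ → Zd 3) (R : ℕ → ℤ),
      (∀ k : ℕ, (k : ℝ) + 1 ≤ R k) → (∀ (k : ℕ) (y : Zd 3), ‖u k y‖ = 1) →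
      (∀ k : ℕ, ∑ y ∈ box (z k) (R k), ∑ μ : Fin 3, ‖(u k) (y + unitVec μ) - (u k) y‖ ^ 2 ≤ Λ₀ * R k) →
      ∃ (U : EuclideanSpace ℝ (Fin 3) → EuclideanSpace ℝ (Fin 4)) (φ : ℕ → ℕ), StrictMono φ ∧
        AEStronglyMeasurable U (volume.restrict {x : EuclideanSpace ℝ (Fin 3) | ∀ i : Fin 3, |x i| < 1}) ∧
        (∀ᵐ x ∂(volume.restrict {x : EuclideanSpace ℝ (Fin 3) | ∀ i : Fin 3, |x i| < 1}), ‖U x‖ = 1) ∧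
        Tendsto (fun k : ℕ => ∫ x in {x : EuclideanSpace ℝ (Fin 3) | ∀ i : Fin 3, |x i| < 1},
            ‖u (φ k) (z (φ k) + fun i => ⌊(R (φ k) : ℝ) * x i⌋) - U x‖ ^ 2) atTop (𝓝 0) ∧
        (∀ (m : ℕ) (j : Fin 3 → Fin (2 ^ m)) (μ : Fin 3), ∃ g : EuclideanSpace ℝ (Fin 4),
          Tendsto (fun k : ℕ => ∫ x in {x : EuclideanSpace ℝ (Fin 3) |
                ∀ i : Fin 3, (-1 : ℝ) + 2 * (j i : ℕ) / (2 : ℝ) ^ m ≤ x i ∧ x i < (-1 : ℝ) + 2 * ((j i : ℕ) + 1) / (2 : ℝ) ^ m},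
              (R (φ k) : ℝ) • (u (φ k) ((z (φ k) + fun i => ⌊(R (φ k) : ℝ) * x i⌋) + unitVec μ)
                - u (φ k) (z (φ k) + fun i => ⌊(R (φ k) : ℝ) * x i⌋))) atTop (𝓝 g)))
    (h2 : ∀ (Λ₀ : ℝ), 0 < Λ₀ → ∀ (u : ℕ → Zd 3 → EuclideanSpace ℝ (Fin 4)) (z : ℕ → Zd 3) (R : ℕ → ℤ),
      (∀ k : ℕ, (k : ℝ) + 1 ≤ R k) → (∀ (k : ℕ) (y : Zd 3), ‖u k y‖ = 1) →
      (∀ k : ℕ, (∀ (z' : Zd 3) (ρ : ℤ), 0 ≤ ρ → box z' (ρ + 1) ⊆ box (z k) (R k) →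
        ∀ v : Zd 3 → EuclideanSpace ℝ (Fin 4), (∀ y, y ∉ box z' ρ → v y = (u k) y) → (∀ y ∈ box z' ρ, ‖v y‖ = 1) →
        ∑ y ∈ box z' (ρ + 1), ∑ μ : Fin 3, ‖(u k) (y + unitVec μ) - (u k) y‖ ^ 2 ≤
        (∑ y ∈ box z' (ρ + 1), ∑ μ : Fin 3, ‖v (y + unitVec μ) - v y‖ ^ 2) + (1 / ((k : ℝ) + 1)) * ((ρ : ℝ) + 1))) →
      (∀ k : ℕ, ∑ y ∈ box (z k) (R k), ∑ μ : Fin 3, ‖(u k) (y + unitVec μ) - (u k) y‖ ^ 2 ≤ Λ₀ * R k) →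
      ∀ (U₀ : EuclideanSpace ℝ (Fin 3) → EuclideanSpace ℝ (Fin 4)) (φ₀ : ℕ → ℕ), StrictMono φ₀ →
      AEStronglyMeasurable U₀ (volume.restrict {x : EuclideanSpace ℝ (Fin 3) | ∀ i : Fin 3, |x i| < 1}) →
      (∀ᵐ x ∂(volume.restrict {x : EuclideanSpace ℝ (Fin 3) | ∀ i : Fin 3, |x i| < 1}), ‖U₀ x‖ = 1) →
      Tendsto (fun k : ℕ => ∫ x in {x : EuclideanSpace ℝ (Fin 3) | ∀ i : Fin 3, |x i| < 1},
            ‖u (φ₀ k) (z (φ₀ k) + fun i => ⌊(R (φ₀ k) : ℝ) * x i⌋) - U₀ x‖ ^ 2) atTop (𝓝 0) →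
      (∀ (m : ℕ) (j : Fin 3 → Fin (2 ^ m)) (μ : Fin 3), ∃ g : EuclideanSpace ℝ (Fin 4),
          Tendsto (fun k : ℕ => ∫ x in {x : EuclideanSpace ℝ (Fin 3) |
                ∀ i : Fin 3, (-1 : ℝ) + 2 * (j i : ℕ) / (2 : ℝ) ^ m ≤ x i ∧ x i < (-1 : ℝ) + 2 * ((j i : ℕ) + 1) / (2 : ℝ) ^ m},
              (R (φ₀ k) : ℝ) • (u (φ₀ k) ((z (φ₀ k) + fun i => ⌊(R (φ₀ k) : ℝ) * x i⌋) + unitVec μ)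
                - u (φ₀ k) (z (φ₀ k) + fun i => ⌊(R (φ₀ k) : ℝ) * x i⌋))) atTop (𝓝 g)) →
      ∀ (hQ : IsOpen {x : EuclideanSpace ℝ (Fin 3) | ∀ i : Fin 3, |x i| < 1}), ∃ (U : EuclideanSpace ℝ (Fin 3) → EuclideanSpace ℝ (Fin 4)) (G : EuclideanSpace ℝ (Fin 3) → (EuclideanSpace ℝ (Fin 3) →L[ℝ] EuclideanSpace ℝ (Fin 4))) (φ : ℕ → ℕ),
      StrictMono φ ∧ (∃ ψ : ℕ → ℕ, StrictMono ψ ∧ ∀ k : ℕ, φ k = φ₀ (ψ k)) ∧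
      (∀ᵐ x ∂(volume.restrict {x : EuclideanSpace ℝ (Fin 3) | ∀ i : Fin 3, |x i| < 1}), U x = U₀ x) ∧
      Literature.Analysis.FunctionSpaces.HasWeakFDerivOn ⟨{x : EuclideanSpace ℝ (Fin 3) | ∀ i : Fin 3, |x i| < 1}, hQ⟩ volume U G ∧
      (∀ x : EuclideanSpace ℝ (Fin 3), (∀ i : Fin 3, |x i| < 1) → ‖U x‖ = 1) ∧
      MeasureTheory.IntegrableOn (fun x => ∑ i : Fin 3, ‖G x (EuclideanSpace.single i (1:ℝ))‖ ^ 2)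
        {x : EuclideanSpace ℝ (Fin 3) | ∀ i : Fin 3, |x i| < 1} ∧
      (∀ (V : EuclideanSpace ℝ (Fin 3) → EuclideanSpace ℝ (Fin 4)) (GV : EuclideanSpace ℝ (Fin 3) → (EuclideanSpace ℝ (Fin 3) →L[ℝ] EuclideanSpace ℝ (Fin 4))) (s : ℝ), s < 1 →
        Literature.Analysis.FunctionSpaces.HasWeakFDerivOn ⟨{x : EuclideanSpace ℝ (Fin 3) | ∀ i : Fin 3, |x i| < 1}, hQ⟩ volume V GV →
        (∀ x : EuclideanSpace ℝ (Fin 3), (∀ i : Fin 3, |x i| < 1) → ‖V x‖ = 1) →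
        MeasureTheory.IntegrableOn (fun x => ∑ i : Fin 3, ‖GV x (EuclideanSpace.single i (1:ℝ))‖ ^ 2)
        {x : EuclideanSpace ℝ (Fin 3) | ∀ i : Fin 3, |x i| < 1} →
        (∀ x : EuclideanSpace ℝ (Fin 3), (∃ i : Fin 3, s ≤ |x i|) → V x = U x) →
        ∫ x in {x : EuclideanSpace ℝ (Fin 3) | ∀ i : Fin 3, |x i| < 1}, ∑ i : Fin 3, ‖G x (EuclideanSpace.single i (1:ℝ))‖ ^ 2 ≤
          ∫ x in {x : EuclideanSpace ℝ (Fin 3) | ∀ i : Fin 3, |x i| < 1}, ∑ i : Fin 3, ‖GV x (EuclideanSpace.single i (1:ℝ))‖ ^ 2) ∧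
      ∫ x in {x : EuclideanSpace ℝ (Fin 3) | ∀ i : Fin 3, |x i| < 1}, ∑ i : Fin 3, ‖G x (EuclideanSpace.single i (1:ℝ))‖ ^ 2 ≤ Λ₀ ∧
      ∀ (r₀ η : ℝ), 0 < r₀ → r₀ ≤ 1 / 8 → 0 < η → ∃ r : ℝ, r₀ / 2 ≤ r ∧ r ≤ r₀ ∧ ∃ k₀ : ℕ, ∀ k : ℕ, k₀ ≤ k →
        ∃ ρ : ℤ, r * (R (φ k) : ℝ) ≤ ρ ∧ (ρ : ℝ) ≤ 2 * r * R (φ k) ∧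
        ∑ y ∈ box (z (φ k)) (2 * ρ), ∑ μ : Fin 3, ‖(u (φ k)) (y + unitVec μ) - (u (φ k)) y‖ ^ 2 ≤
          (R (φ k) : ℝ) * ((∫ x in {x : EuclideanSpace ℝ (Fin 3) | ∀ i : Fin 3, |x i| < (5 * r)}, ∑ i : Fin 3, ‖G x (EuclideanSpace.single i (1:ℝ))‖ ^ 2) + η)) :
    ∀ (Λ₀ ε₁ : ℝ), 0 < Λ₀ → Λ₀ ≤ 21 → 0 < ε₁ →
      ∃ (δ C₀ R₀ : ℝ), 0 < δ ∧ 1 ≤ C₀ ∧ 1 ≤ R₀ ∧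
      ∀ (u : Zd 3 → EuclideanSpace ℝ (Fin 4)) (z : Zd 3) (R : ℤ),
      R₀ ≤ R →
      (∀ y, ‖u y‖ = 1) →
      (∀ (z' : Zd 3) (ρ : ℤ), 0 ≤ ρ → box z' (ρ + 1) ⊆ box z R →
      ∀ v : Zd 3 → EuclideanSpace ℝ (Fin 4), (∀ y, y ∉ box z' ρ → v y = u y) → (∀ y ∈ box z' ρ, ‖v y‖ = 1) →
      ∑ y ∈ box z' (ρ + 1), ∑ μ : Fin 3, ‖u (y + unitVec μ) - u y‖ ^ 2 ≤
      (∑ y ∈ box z' (ρ + 1), ∑ μ : Fin 3, ‖v (y + unitVec μ) - v y‖ ^ 2) + δ * ((ρ : ℝ) + 1)) →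
      (∑ y ∈ box z R, ∑ μ : Fin 3, ‖u (y + unitVec μ) - u y‖ ^ 2 ≤ Λ₀ * R) →
      ∃ r : ℤ, 1 ≤ r ∧ (R : ℝ) ≤ C₀ * r ∧ 4 * r ≤ R ∧
      ∑ y ∈ box z (2 * r), ∑ μ : Fin 3, ‖u (y + unitVec μ) - u y‖ ^ 2 ≤ ε₁ * r := by
  intro Λ₀ ε₁ hΛ₀ h21 hε₁
  by_contra H
  -- a counterexample at every level `k` (δ = 1/(k+1), C₀ = R₀ = k+1)
  have hseq : ∀ k : ℕ, ∃ (u : Zd 3 → EuclideanSpace ℝ (Fin 4)) (z : Zd 3) (R : ℤ),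
      ((k : ℝ) + 1 ≤ R) ∧ (∀ y, ‖u y‖ = 1) ∧
      (∀ (z' : Zd 3) (ρ : ℤ), 0 ≤ ρ → box z' (ρ + 1) ⊆ box z R →
        ∀ v : Zd 3 → EuclideanSpace ℝ (Fin 4), (∀ y, y ∉ box z' ρ → v y = u y) → (∀ y ∈ box z' ρ, ‖v y‖ = 1) →
        ∑ y ∈ box z' (ρ + 1), ∑ μ : Fin 3, ‖u (y + unitVec μ) - u y‖ ^ 2 ≤
        (∑ y ∈ box z' (ρ + 1), ∑ μ : Fin 3, ‖v (y + unitVec μ) - v y‖ ^ 2) + (1 / ((k : ℝ) + 1)) * ((ρ : ℝ) + 1)) ∧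
      (∑ y ∈ box z R, ∑ μ : Fin 3, ‖u (y + unitVec μ) - u y‖ ^ 2 ≤ Λ₀ * R) ∧
      ∀ r : ℤ, 1 ≤ r → (R : ℝ) ≤ ((k : ℝ) + 1) * r → 4 * r ≤ R →
        ε₁ * r < ∑ y ∈ box z (2 * r), ∑ μ : Fin 3, ‖u (y + unitVec μ) - u y‖ ^ 2 := by
    intro k
    by_contra hk
    apply H
    have hk0 : (0 : ℝ) ≤ (k : ℝ) := Nat.cast_nonneg k
    refine ⟨1 / ((k : ℝ) + 1), (k : ℝ) + 1, (k : ℝ) + 1, by positivity, by linarith, by linarith, ?_⟩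
    intro u z R hR hu hmin hE
    by_contra hr
    exact hk ⟨u, z, R, hR, hu, hmin, hE, fun r h1r h2r h3r => not_le.mp (fun hle => hr ⟨r, h1r, h2r, h3r, hle⟩)⟩
  choose u z R hR hu hmin hE hbad using hseq
  -- blow down: Γ1 (L²-compactness), then S2♭ (the limit is a smooth local minimiser; energies converge from above along φ = φ₀ ∘ ψ)
  obtain ⟨U₀, φ₀, hφ₀, hm₀, hu₀, hc₀, hg₀⟩ := hΓ Λ₀ hΛ₀ u z R hR hu hE
  have hQ : IsOpen {x : EuclideanSpace ℝ (Fin 3) | ∀ i : Fin 3, |x i| < 1} :=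
    Summit.QuantumFields.YangMills.Theorems.PoincareLipschitzSamplingCells.isOpen_absCube 1
  obtain ⟨U, G, φ, hφ, -, -, hW, hUu, hUint, hUmin, hUE, hconv⟩ :=
    h2 Λ₀ hΛ₀ u z R hR hu hmin hE U₀ φ₀ hφ₀ hm₀ hu₀ hc₀ hg₀ hQ
  -- the continuum fact at `(Λ₀, ε₁/10)`
  obtain ⟨r₁, hr₁, hr₁8, hSU⟩ := h1 Λ₀ (ε₁ / 10) hΛ₀ h21 (by positivity)
  have hsmall := hSU hQ U G hW hUu hUint hUmin hUE
  -- energy convergence at `r₀ = r₁/5`, `η = ε₁ r₁/40`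
  obtain ⟨r, hr_lo, hr_hi, k₀, hk₀⟩ := hconv (r₁ / 5) (ε₁ * r₁ / 40) (by positivity) (by linarith) (by positivity)
  have hr_pos : 0 < r := by linarith
  obtain ⟨N, hN⟩ := exists_nat_ge (1 / r)
  obtain ⟨ρ, hρ_lo, hρ_hi, hEk⟩ := hk₀ (max k₀ N) (le_max_left _ _)
  -- sizes at the index `φ (max k₀ N)`
  have hNk : (N : ℝ) ≤ (φ (max k₀ N) : ℝ) := by
    have : N ≤ φ (max k₀ N) := le_trans (le_max_right _ _) (hφ.id_le _)
    exact_mod_cast this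
  have hRk : (φ (max k₀ N) : ℝ) + 1 ≤ R (φ (max k₀ N)) := hR _
  have hRpos : (0 : ℝ) < R (φ (max k₀ N)) := by
    have : (0 : ℝ) ≤ (φ (max k₀ N) : ℝ) := Nat.cast_nonneg _
    linarith
  have hrinv : 1 / r ≤ (φ (max k₀ N) : ℝ) + 1 := by linarith
  -- (1) `1 ≤ ρ`
  have hrR : 1 ≤ r * (R (φ (max k₀ N)) : ℝ) := by
    have h1 : r * (1 / r) = 1 := by field_simp
    have h2 : r * (1 / r) ≤ r * ((φ (max k₀ N) : ℝ) + 1) := mul_le_mul_of_nonneg_left hrinv hr_pos.le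
    have h3 : r * ((φ (max k₀ N) : ℝ) + 1) ≤ r * (R (φ (max k₀ N)) : ℝ) := mul_le_mul_of_nonneg_left hRk hr_pos.le
    linarith
  have hρpos : (0 : ℝ) < ρ := by linarith
  have hρ1 : (1 : ℤ) ≤ ρ := by
    have : (1 : ℝ) ≤ (ρ : ℝ) := le_trans hrR hρ_lo
    exact_mod_cast this
  -- (2) `R ≤ (k+1)·ρ`
  have hC : (R (φ (max k₀ N)) : ℝ) ≤ ((φ (max k₀ N) : ℝ) + 1) * ρ := by
    have h1 : (R (φ (max k₀ N)) : ℝ) = (1 / r) * (r * R (φ (max k₀ N))) := by field_simp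
    have h2 : (1 / r) * (r * (R (φ (max k₀ N)) : ℝ)) ≤ (1 / r) * ρ := mul_le_mul_of_nonneg_left hρ_lo (by positivity)
    have h3 : (1 / r) * (ρ : ℝ) ≤ ((φ (max k₀ N) : ℝ) + 1) * ρ := mul_le_mul_of_nonneg_right hrinv hρpos.le
    linarith
  -- (3) `4ρ ≤ R`
  have h4 : 4 * ρ ≤ R (φ (max k₀ N)) := by
    have h2r : 2 * r ≤ 1 / 20 := by linarith
    have h5 : 2 * r * (R (φ (max k₀ N)) : ℝ) ≤ 1 / 20 * R (φ (max k₀ N)) := mul_le_mul_of_nonneg_right h2r hRpos.le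
    have : (4 : ℝ) * ρ ≤ R (φ (max k₀ N)) := by linarith
    exact_mod_cast this
  -- the counterexample forbids the scale `ρ` …
  have hlt := hbad (φ (max k₀ N)) ρ hρ1 hC h4
  -- … but the lattice energy there is small
  have h5r := hsmall (5 * r) (by positivity) (by linarith)
  have hRC := mul_le_mul_of_nonneg_left h5r hRpos.le
  have hh2 : ε₁ * r₁ / 40 ≤ ε₁ * r / 4 := by nlinarith [hr_lo, hε₁.le]
  have hh3 := mul_le_mul_of_nonneg_left hh2 hRpos.le
  have hh1 : ε₁ * (r * (R (φ (max k₀ N)) : ℝ)) ≤ ε₁ * ρ := mul_le_mul_of_nonneg_left hρ_lo hε₁.le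
  have hprod : 0 < ε₁ * (r * (R (φ (max k₀ N)) : ℝ)) := by positivity
  rw [mul_add] at hEk
  nlinarith [hEk, hRC, hlt, hh1, hh3, hprod, hRpos.le, hε₁.le, hr_pos.le]

/-! ## §3 The organ, the face, and the crux decls BY NAME — compositions with the K2 chain of record
(★w3 ✓H p715759 `hImproveCoreFlat_of_flatCapped`; K-5 ✓p709591, K-4b ✓p709961, K-3 ✓p707954, K-3c ✓p708615) -/

open Literature.MathematicalPhysics.QuantumFieldTheory.Balaban1983to89.T3ContinuumYM3Torus
open Literature.MathematicalPhysics.QuantumFieldTheory.Balaban1983to89.T3UnitScaleTilt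
open Literature.MathematicalPhysics.QuantumFieldTheory.Balaban1983to89.T3UnitLawDensityEML (ℰp)
open Summit.QuantumFields.YangMills.Theorems.PoincareLipschitzFlatOrganOfFlatCapped (hImproveCoreFlat_of_flatCapped)
open Summit.QuantumFields.YangMills.Theorems.PoincareLipschitzImproveCoreOfFlat (hImproveCore_of_flat)
open Summit.QuantumFields.YangMills.Theorems.PoincareLipschitzImproveOfCore (hImprove_of_core)
open Summit.QuantumFields.YangMills.Theorems.PoincareLipschitzOrbitMinHolderRegularityOfImprove (blockLipschitzL_of_hImprove)
open Summit.QuantumFields.YangMills.Theorems.PoincareLipschitzHistoryTailOfImprove (historyTailL_of_hImprove)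

/-- ★★★ **THE ORGAN OF RECORD `hImproveCoreFlat` (FROZEN v1 bac8eda30a54887f, VERBATIM) from the stubs — ROAD (i), K-INDEPENDENT:** ★w3 ✓H
`hImproveCoreFlat_of_flatCapped` (the flat organ at the single level `21` implies it at every level, by the log-cutoff stability cap) applied to
(Γ6-band) at `Λ₀ := 21`. [cite: SchoenUhlenbeck1984, §2; SchoenUhlenbeck1982, Thm IV; Luckhaus1988, Thm 2] -/
theorem hImproveCoreFlat_of :
    ∀ (Λ₀ ε₁ : ℝ), 0 < Λ₀ → 0 < ε₁ →
      ∃ (δ C₀ R₀ : ℝ), 0 < δ ∧ 1 ≤ C₀ ∧ 1 ≤ R₀ ∧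
      ∀ (u : Zd 3 → EuclideanSpace ℝ (Fin 4)) (z : Zd 3) (R : ℤ),
      R₀ ≤ R →
      (∀ y, ‖u y‖ = 1) →
      (∀ (z' : Zd 3) (ρ : ℤ), 0 ≤ ρ → box z' (ρ + 1) ⊆ box z R →
      ∀ v : Zd 3 → EuclideanSpace ℝ (Fin 4), (∀ y, y ∉ box z' ρ → v y = u y) → (∀ y ∈ box z' ρ, ‖v y‖ = 1) →
      ∑ y ∈ box z' (ρ + 1), ∑ μ : Fin 3, ‖u (y + unitVec μ) - u y‖ ^ 2 ≤
      (∑ y ∈ box z' (ρ + 1), ∑ μ : Fin 3, ‖v (y + unitVec μ) - v y‖ ^ 2) + δ * ((ρ : ℝ) + 1)) →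
      (∑ y ∈ box z R, ∑ μ : Fin 3, ‖u (y + unitVec μ) - u y‖ ^ 2 ≤ Λ₀ * R) →
      ∃ r : ℤ, 1 ≤ r ∧ (R : ℝ) ≤ C₀ * r ∧ 4 * r ≤ R ∧
      ∑ y ∈ box z (2 * r), ∑ μ : Fin 3, ‖u (y + unitVec μ) - u y‖ ^ 2 ≤ ε₁ * r :=
  hImproveCoreFlat_of_flatCapped (fun ε₁ hε₁ =>
    hImproveCoreFlatBand_of stub_uniformSmallScaleEnergy stub_blowDownL2Compact stub_latticeToContinuumLimit 21 ε₁ (by norm_num) le_rfl hε₁)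

/-- ★★★ **THE K2 FACE OF THE DISPLAY v4 «THE FACE IS THE BAND» — `hHalvingBand` v1 (LEAD w1 g9 FROZEN ba43742f358b062d) VERBATIM from the stubs —
ROAD (ii):** (Γ6-band) at `(Λ₀, ε₁) = (Λ, Λ)`, `0 < Λ ≤ 21`; feeds K-7 `PoincareLipschitzHistoryTailOfHalvingBand.historyTailL_of_halvingBand (hK1) (hHB) (hM)`
(⧗p718708) as `hHB` when it lands. [cite: SchoenUhlenbeck1982, §§2–4; Luckhaus1988, Thm 2] -/
theorem hHalvingBand_of :
    ∀ Λ : ℝ, 0 < Λ → Λ ≤ 21 →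
      ∃ (δ C₀ R₀ : ℝ), 0 < δ ∧ 1 ≤ C₀ ∧ 1 ≤ R₀ ∧
      ∀ (u : Zd 3 → EuclideanSpace ℝ (Fin 4)) (z : Zd 3) (R : ℤ),
        R₀ ≤ R →
        (∀ y, ‖u y‖ = 1) →
        (∀ (z' : Zd 3) (ρ : ℤ), 0 ≤ ρ → box z' (ρ + 1) ⊆ box z R →
          ∀ v : Zd 3 → EuclideanSpace ℝ (Fin 4), (∀ y, y ∉ box z' ρ → v y = u y) → (∀ y ∈ box z' ρ, ‖v y‖ = 1) →
            ∑ y ∈ box z' (ρ + 1), ∑ μ : Fin 3, ‖u (y + unitVec μ) - u y‖ ^ 2 ≤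
              (∑ y ∈ box z' (ρ + 1), ∑ μ : Fin 3, ‖v (y + unitVec μ) - v y‖ ^ 2) + δ * ((ρ : ℝ) + 1)) →
        (∑ y ∈ box z R, ∑ μ : Fin 3, ‖u (y + unitVec μ) - u y‖ ^ 2 ≤ Λ * R) →
        ∃ r : ℤ, 1 ≤ r ∧ (R : ℝ) ≤ C₀ * r ∧ 4 * r ≤ R ∧
          ∑ y ∈ box z (2 * r), ∑ μ : Fin 3, ‖u (y + unitVec μ) - u y‖ ^ 2 ≤ Λ * r :=
  fun Λ hΛ h21 => hImproveCoreFlatBand_of stub_uniformSmallScaleEnergy stub_blowDownL2Compact stub_latticeToContinuumLimit Λ Λ hΛ h21 hΛ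

/-- ★★★ **THE K2 CRUX `PoincareLipschitz.BlockLipschitzL` (stmt-QuantumFields-23533) from the stubs BY NAME** — kernel-checked composition
`hImproveCoreFlat_of` ∘ K-5 `hImproveCore_of_flat` ∘ K-4b `hImprove_of_core` ∘ K-3 `blockLipschitzL_of_hImprove`.  This is the registered conclusion of the
line. [cite: SchoenUhlenbeck1982, Thm IV; Luckhaus1988, Thm 2; Balaban1985Averaging, Prop. 1] -/
theorem BlockLipschitzL_of :
    Summit.QuantumFields.YangMills.Theses.PoincareLipschitz.BlockLipschitzL :=
  blockLipschitzL_of_hImprove (hImprove_of_core (hImproveCore_of_flat hImproveCoreFlat_of))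

/-- ★★★ **THE CRUX OF RECORD `UnitScaleTilt.HistoryTailL` (stmt-QuantumFields-19936) BY NAME** from the stubs, GIVEN the two other open organs of the K2
display of record (✓p700135 / ✓p708615): (K1-exp) weak-coupling exponential concentration of gauge-invariant Lipschitz box observables (binder `hK1`,
verbatim from `historyTailL_of_hImprove`) and the first-moment item `PoincareLipschitz.MeanDeviationL` (stmt-QuantumFields-23083, by name).  Not a claim
that 19936 follows from the stubs alone. [cite: Balaban1985UV3, (71) p.273; SchoenUhlenbeck1982, §4] -/
theorem HistoryTailL_of
    (hK1 : ∀ (L : ℕ), ∃ (Cc cc : ℝ), 0 ≤ Cc ∧ 0 < cc ∧ ∃ γ₁ : ℝ, 0 < γ₁ ∧ γ₁ ≤ 1 ∧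
      ∀ (F : T3Family) (γ : ℝ), F.L = L → 0 < γ → γ ≤ γ₁ → ∀ (K n : ℕ), 1 ≤ n →
        (n : ℝ) ≤ (F.scheme ℰp γ).β K → 2 * n ≤ (F.P K).sitesPerDir 0 →
        ∀ (x₀ : Site (F.P K) 0) (f : GaugeField (F.P K) 0 (Matrix.specialUnitaryGroup (Fin 2) ℂ) → ℝ) (Λ : ℝ), 0 < Λ →
          Measurable f → GaugeField.GaugeInvariant f →
          (∀ U U' : GaugeField (F.P K) 0 (Matrix.specialUnitaryGroup (Fin 2) ℂ),
            (∀ b : PBond (F.P K) 0, (∀ k, (b.src k - x₀ k).val < n) → (∀ k, (b.tgt k - x₀ k).val < n) → U b = U' b) →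
              f U = f U') →
          (∀ U U' : GaugeField (F.P K) 0 (Matrix.specialUnitaryGroup (Fin 2) ℂ),
            |f U - f U'| ≤ Λ * Real.sqrt (∑ b : PBond (F.P K) 0, GaugeGroup.dist1 (U b * (U' b)⁻¹) ^ 2)) →
          ∀ r : ℝ, 0 ≤ r →
            (gibbsK F ℰp γ K).real {U | r ≤ f U - ∫ V, f V ∂(gibbsK F ℰp γ K)} ≤
              Cc * Real.exp (-(cc * Real.sqrt ((F.scheme ℰp γ).β K) * r / ((n : ℝ) * Λ))))
    (hM : Summit.QuantumFields.YangMills.Theses.PoincareLipschitz.MeanDeviationL) :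
    Summit.QuantumFields.YangMills.Theses.UnitScaleTilt.HistoryTailL :=
  historyTailL_of_hImprove hK1 (hImprove_of_core (hImproveCore_of_flat hImproveCoreFlat_of)) hM

end Summit.QuantumFields.YangMills.Cruxes.HistoryTailL.CompactnessTransfer

end
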